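import Literature.MathematicalPhysics.QuantumLattice.ClusteringFromCommutatorBounds
import Literature.MathematicalPhysics.QuantumLattice.SectorSpectrum
import HarnessLib

/-!
# Sector-relative clustering of odd–odd correlations from one-sided gaps (Hastings–Koma, graded form)

Companion of `ClusteringFromCommutatorBounds.lean` (`clustering_of_commutator_bounds`: unique
gapped ground state, commuting observables). Here: `H` Hermitian, `ψ` a normalised eigenvector
(`Hψ = E₀ψ`, no uniqueness, no gap in its own sector), two ANTIcommuting observables `A`, `B`
(`{A, B} = 0`), and two `H`-invariant COORDINATE blocks `K₋ = {v | v ≡ 0 off p₁}`, `K₊` such that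
`Bψ ∈ K₋`, `Aψ ∈ K₊` and `H ≥ E₀ + γ` (Rayleigh) on `K₋` and on `K₊` — the one-sided gaps of the
charged sectors `N ∓ 1` reached by `c_{yτ} ψ` and `c†_{xσ} ψ` after the shift `H − μN` in the
application (route `HubbardSuperconductivity/ParityGapRigidity`, item `ParityGapClustering`).
Given the Lipschitz input `‖[H, B]‖ ≤ 2‖B‖ c_Y N` and the ANTIcommutator Lieb–Robinson input
`‖{τ_t(B), A}‖ ≤ C‖B‖‖A‖ m e^{-μ(D - v|t|)}`:
`|⟨ψ, A B ψ⟩| ≤ (2 + 4N + 4C/(vμ) + 8v/γ) ‖A‖‖B‖ c_Y e^{-D/ξ}`, `ξ = max(8/μ, 4v/γ)`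
(`sector_clustering_of_anticommutator_bounds`).

Proof = Hastings–Koma, CMP 265 (2006) §3 (proof of Thm. 8, and Thm. 6 "clustering of fermionic
correlations") with the graded commutator, through the tree's filter lemma
`abstract_clustering_bound` and arithmetic `clustering_arith`: expand
`h(t) = ⟨ψ, {A, τ_t(B)} ψ⟩` in an eigenbasis of `H` (`anticommutator_expect_eq_sum`); a mode with a
nonzero weight `⟨vᵢ, Bψ⟩` (resp. `⟨vᵢ, Aψ⟩`) has a nonzero component in `K₋` (resp. `K₊`), which is
again an eigenvector with the same eigenvalue (block structure), whence `λᵢ ≥ E₀ + γ` by the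
Rayleigh hypothesis (`eigenvalue_ge_of_block`); the modes without weight are irrelevant, and there
is NO ground-state term (`i₀` is a dummy index), so the conclusion bounds `⟨ψ, ABψ⟩` itself.
No definitions.
-/

noncomputable section

open Matrix Complex Finset Real
open scoped Matrix.Norms.L2Operator ComplexOrder InnerProductSpace

namespace Literature.MathematicalPhysics.QuantumLattice

variable {m : Type*} [Fintype m] [DecidableEq m]

/-- **Spectral representation of the ANTIcommutator expectation** `h(t) = ⟨ψ, {A, τ_t(B)} ψ⟩` in a
vector `ψ` with `Hψ = E₀ψ`:
`h(t) = Σᵢ (⟨ψ,Avᵢ⟩⟨vᵢ,Bψ⟩ e^{it(λᵢ-E₀)} + ⟨ψ,Bvᵢ⟩⟨vᵢ,Aψ⟩ e^{-it(λᵢ-E₀)})` (as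
`commutator_expect_eq_sum`, HK06 §3, with the sign of the graded commutator).
[cite: HastingsKomaCMP2006, §3] -/
theorem anticommutator_expect_eq_sum {H : Matrix m m ℂ} (hH : H.IsHermitian) (A B : Matrix m m ℂ)
    {ψ : m → ℂ} {E₀ : ℝ} (hψ : H *ᵥ ψ = (E₀ : ℂ) • ψ) (t : ℝ) :
    star ψ ⬝ᵥ ((A * heisenbergEvolution H t B + heisenbergEvolution H t B * A) *ᵥ ψ) =
      ∑ i, ((star ψ ⬝ᵥ (A *ᵥ ⇑(hH.eigenvectorBasis i))) *
              (star (⇑(hH.eigenvectorBasis i)) ⬝ᵥ (B *ᵥ ψ)) *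
              cexp (((t * (hH.eigenvalues i - E₀) : ℝ) : ℂ) * I) +
            (star ψ ⬝ᵥ (B *ᵥ ⇑(hH.eigenvectorBasis i))) *
              (star (⇑(hH.eigenvectorBasis i)) ⬝ᵥ (A *ᵥ ψ)) *
              cexp (-((t * (hH.eigenvalues i - E₀) : ℝ) : ℂ) * I)) := by
  set U := NormedSpace.exp ((I * (t : ℂ)) • H) with hU
  set V := NormedSpace.exp ((-(I * (t : ℂ))) • H) with hV
  have hVψ : V *ᵥ ψ = cexp (-(I * t) * E₀) • ψ := exp_smul_mulVec_of_mulVec_eq H hψ _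
  have hUH : Uᴴ = V := conjTranspose_exp_I_mul_smul hH t
  have h1 : star ψ ⬝ᵥ (A *ᵥ (U *ᵥ (B *ᵥ (V *ᵥ ψ)))) =
      ∑ i, (star ψ ⬝ᵥ (A *ᵥ ⇑(hH.eigenvectorBasis i))) *
        (star (⇑(hH.eigenvectorBasis i)) ⬝ᵥ (B *ᵥ ψ)) *
        cexp (((t * (hH.eigenvalues i - E₀) : ℝ) : ℂ) * I) := by
    rw [hVψ, mulVec_smul, mulVec_smul, mulVec_smul, dotProduct_smul, smul_eq_mul, hU,
      dotProduct_mulVec_exp_mulVec hH A ψ (B *ᵥ ψ) (I * t), Finset.mul_sum]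
    refine Finset.sum_congr rfl fun i _ => ?_
    rw [show cexp (-(I * ↑t) * ↑E₀) * (cexp (I * ↑t * ↑(hH.eigenvalues i)) *
        (star ⇑(hH.eigenvectorBasis i) ⬝ᵥ B *ᵥ ψ) * (star ψ ⬝ᵥ A *ᵥ ⇑(hH.eigenvectorBasis i))) =
        (star ψ ⬝ᵥ A *ᵥ ⇑(hH.eigenvectorBasis i)) * (star ⇑(hH.eigenvectorBasis i) ⬝ᵥ B *ᵥ ψ) *
        (cexp (-(I * ↑t) * ↑E₀) * cexp (I * ↑t * ↑(hH.eigenvalues i))) by ring,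
      ← Complex.exp_add]
    congr 2
    push_cast
    ring
  have h2 : star ψ ⬝ᵥ (U *ᵥ (B *ᵥ (V *ᵥ (A *ᵥ ψ)))) =
      ∑ i, (star ψ ⬝ᵥ (B *ᵥ ⇑(hH.eigenvectorBasis i))) *
        (star (⇑(hH.eigenvectorBasis i)) ⬝ᵥ (A *ᵥ ψ)) *
        cexp (-((t * (hH.eigenvalues i - E₀) : ℝ) : ℂ) * I) := by
    rw [dotProduct_mulVec, ← conjTranspose_conjTranspose U, ← star_mulVec, hUH, hVψ, star_smul,
      smul_dotProduct, smul_eq_mul, hV, dotProduct_mulVec_exp_mulVec hH B ψ (A *ᵥ ψ) (-(I * t)),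
      Finset.mul_sum]
    refine Finset.sum_congr rfl fun i _ => ?_
    have hstar : star (cexp (-(I * ↑t) * ↑E₀)) = cexp (I * ↑t * ↑E₀) := by
      rw [Complex.star_def, ← Complex.exp_conj]
      congr 1
      simp [Complex.conj_ofReal]
    rw [hstar, show cexp (I * ↑t * ↑E₀) * (cexp (-(I * ↑t) * ↑(hH.eigenvalues i)) *
        (star ⇑(hH.eigenvectorBasis i) ⬝ᵥ A *ᵥ ψ) * (star ψ ⬝ᵥ B *ᵥ ⇑(hH.eigenvectorBasis i))) =
        (star ψ ⬝ᵥ B *ᵥ ⇑(hH.eigenvectorBasis i)) * (star ⇑(hH.eigenvectorBasis i) ⬝ᵥ A *ᵥ ψ) *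
        (cexp (I * ↑t * ↑E₀) * cexp (-(I * ↑t) * ↑(hH.eigenvalues i))) by ring,
      ← Complex.exp_add]
    congr 2
    push_cast
    ring
  rw [heisenbergEvolution, ← hU, ← hV, add_mulVec, dotProduct_add]
  simp only [← mulVec_mulVec]
  rw [h1, h2, ← Finset.sum_add_distrib]

omit [DecidableEq m] in
/-- **Block structure ⟹ eigenvalues with a component in the block obey the block's Rayleigh
bound.** Let `H` be Hermitian with no entries from the coordinate block `p` into its complement
(hence, by Hermiticity, none back), let `E ≤ Re⟨u, Hu⟩` for all unit `u` supported on `p`, and let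
`Hv = λv` with `v` not identically zero on `p`. Then `E ≤ λ`. [folklore] -/
theorem eigenvalue_ge_of_block {H : Matrix m m ℂ} (hH : H.IsHermitian) (p : m → Prop)
    [DecidablePred p] (hblock : ∀ j k, ¬ p j → p k → H j k = 0) {E : ℝ}
    (hray : ∀ u : m → ℂ, (∀ j, ¬ p j → u j = 0) → star u ⬝ᵥ u = 1 → E ≤ (star u ⬝ᵥ H *ᵥ u).re)
    {v : m → ℂ} {lam : ℝ} (hv : H *ᵥ v = (lam : ℂ) • v) (hvp : ∃ j, p j ∧ v j ≠ 0) : E ≤ lam := by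
  -- the truncation of `v` to the block
  set w : m → ℂ := fun j => if p j then v j else 0 with hw
  have hblock' : ∀ j k, p j → ¬ p k → H j k = 0 := by
    intro j k hj hk
    have h := hblock k j hk hj
    have := congrFun (congrFun hH.eq j) k
    rw [conjTranspose_apply, h, star_zero] at this
    exact this.symm
  have hHw : H *ᵥ w = (lam : ℂ) • w := by
    funext j
    by_cases hj : p j
    · have hvj := congrFun hv j
      simp only [mulVec, dotProduct, Pi.smul_apply, smul_eq_mul] at hvj ⊢
      rw [hw]
      simp only [hj, if_true]
      rw [← hvj]
      refine Finset.sum_congr rfl fun k _ => ?_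
      by_cases hk : p k
      · simp [hk]
      · rw [hblock' j k hj hk]; simp [hk]
    · simp only [mulVec, dotProduct, Pi.smul_apply, smul_eq_mul, hw, hj, if_false, mul_zero]
      refine Finset.sum_eq_zero fun k _ => ?_
      by_cases hk : p k
      · rw [hblock j k hj hk, zero_mul]
      · simp [hk]
  have hw0 : w ≠ 0 := by
    obtain ⟨j, hj, hvj⟩ := hvp
    intro h0
    have := congrFun h0 j
    simp only [hw, hj, if_true, Pi.zero_apply] at this
    exact hvj this
  have hwp : ∀ j, ¬ p j → w j = 0 := fun j hj => by simp [hw, hj]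
  -- normalise
  obtain ⟨c, hc, hc1⟩ := exists_smul_unit hw0
  have hu := hray (c • w) (fun j hj => by simp [hwp j hj]) hc1
  rw [mulVec_smul, hHw, smul_comm, dotProduct_smul, hc1, smul_eq_mul, mul_one,
    Complex.ofReal_re] at hu
  exact hu

/-- **Sector-relative clustering from anticommutator bounds (graded Hastings–Koma).** See the module
docstring. [cite: HastingsKomaCMP2006, §3 (proof of Theorem 8) and Theorem 6] -/
theorem sector_clustering_of_anticommutator_bounds {H A B : Matrix m m ℂ} (hH : H.IsHermitian)
    {γ C μ v D N cY mXY : ℝ} (hγ : 0 < γ) (hC : 0 ≤ C) (hμ : 0 < μ) (hv : 0 < v) (hN : 0 ≤ N)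
    (hcY : 1 ≤ cY) (hm0 : 0 ≤ mXY) (hm : mXY ≤ cY)
    {ψ : m → ℂ} {E₀ : ℝ} (hψ : H *ᵥ ψ = (E₀ : ℂ) • ψ) (hψ1 : star ψ ⬝ᵥ ψ = 1)
    (p₁ p₂ : m → Prop) [DecidablePred p₁] [DecidablePred p₂]
    (hK₁ : ∀ j k, ¬ p₁ j → p₁ k → H j k = 0) (hK₂ : ∀ j k, ¬ p₂ j → p₂ k → H j k = 0)
    (hBψ : ∀ j, ¬ p₁ j → (B *ᵥ ψ) j = 0) (hAψ : ∀ j, ¬ p₂ j → (A *ᵥ ψ) j = 0)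
    (hgap₁ : ∀ u : m → ℂ, (∀ j, ¬ p₁ j → u j = 0) → star u ⬝ᵥ u = 1 →
      E₀ + γ ≤ (star u ⬝ᵥ H *ᵥ u).re)
    (hgap₂ : ∀ u : m → ℂ, (∀ j, ¬ p₂ j → u j = 0) → star u ⬝ᵥ u = 1 →
      E₀ + γ ≤ (star u ⬝ᵥ H *ᵥ u).re)
    (hAB : A * B + B * A = 0)
    (hcomm : ‖H * B - B * H‖ ≤ 2 * ‖B‖ * (cY * N))
    (hLR : ∀ t : ℝ, ‖heisenbergEvolution H t B * A + A * heisenbergEvolution H t B‖ ≤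
      C * ‖B‖ * ‖A‖ * mXY * Real.exp (-μ * (D - v * |t|)))
    (hD : max (2 * v) 1 ≤ D) :
    ‖opExpect (A * B) ψ‖ ≤
      (2 + 4 * N + 4 * C / (v * μ) + 8 * v / γ) * ‖A‖ * ‖B‖ * cY *
        Real.exp (-D / max (8 / μ) (4 * v / γ)) := by
  have hD1 : 1 ≤ D := le_trans (le_max_right _ _) hD
  have hD2v : 2 * v ≤ D := le_trans (le_max_left _ _) hD
  have hD0 : 0 < D := lt_of_lt_of_le one_pos hD1
  -- the weights along the eigenbasis, indexed by `Option m` (`none` = dummy ground index)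
  set e := hH.eigenvectorBasis with he
  obtain ⟨a', ha'⟩ : ∃ a' : m → ℂ, ∀ i, a' i =
      (star ψ ⬝ᵥ (A *ᵥ ⇑(e i))) * (star (⇑(e i)) ⬝ᵥ (B *ᵥ ψ)) := ⟨_, fun i => rfl⟩
  obtain ⟨b', hb'⟩ : ∃ b' : m → ℂ, ∀ i, b' i =
      (star ψ ⬝ᵥ (B *ᵥ ⇑(e i))) * (star (⇑(e i)) ⬝ᵥ (A *ᵥ ψ)) := ⟨_, fun i => rfl⟩
  obtain ⟨a, ha⟩ : ∃ a : Option m → ℂ, ∀ o, a o = Option.elim o 0 a' := ⟨_, fun o => rfl⟩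
  obtain ⟨b, hb⟩ : ∃ b : Option m → ℂ, ∀ o, b o = Option.elim o 0 (fun i => -b' i) := ⟨_, fun o => rfl⟩
  obtain ⟨Δ, hΔ⟩ : ∃ Δ : Option m → ℝ, ∀ o, Δ o = Option.elim o 0
      (fun i => if a' i = 0 ∧ b' i = 0 then γ else hH.eigenvalues i - E₀) := ⟨_, fun o => rfl⟩
  obtain ⟨hfun, hhfun⟩ : ∃ hfun : ℝ → ℂ, ∀ t, hfun t =
      star ψ ⬝ᵥ ((A * heisenbergEvolution H t B + heisenbergEvolution H t B * A) *ᵥ ψ) :=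
    ⟨_, fun t => rfl⟩
  -- hypotheses of the abstract bound
  have hΔ₀ : Δ none = 0 := by rw [hΔ]; rfl
  have hgapmode : ∀ i : m, ¬ (a' i = 0 ∧ b' i = 0) → E₀ + γ ≤ hH.eigenvalues i := by
    intro i hi
    have hev : H *ᵥ ⇑(e i) = ((hH.eigenvalues i : ℝ) : ℂ) • ⇑(e i) := by
      rw [he, hH.mulVec_eigenvectorBasis i]
      funext k
      simp only [Pi.smul_apply, Complex.real_smul, smul_eq_mul]
    rcases not_and_or.mp hi with ha0 | hb0
    · -- `⟨e i, Bψ⟩ ≠ 0` forces a component in `K₋`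
      have hne : star (⇑(e i)) ⬝ᵥ (B *ᵥ ψ) ≠ 0 := by
        intro h0; apply ha0; rw [ha', h0, mul_zero]
      have hvp : ∃ j, p₁ j ∧ (⇑(e i)) j ≠ 0 := by
        by_contra hno
        push Not at hno
        apply hne
        rw [dotProduct]
        refine Finset.sum_eq_zero fun j _ => ?_
        by_cases hj : p₁ j
        · rw [Pi.star_apply, hno j hj, star_zero, zero_mul]
        · rw [hBψ j hj, mul_zero]
      exact eigenvalue_ge_of_block hH p₁ hK₁ hgap₁ hev hvp
    · have hne : star (⇑(e i)) ⬝ᵥ (A *ᵥ ψ) ≠ 0 := by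
        intro h0; apply hb0; rw [hb', h0, mul_zero]
      have hvp : ∃ j, p₂ j ∧ (⇑(e i)) j ≠ 0 := by
        by_contra hno
        push Not at hno
        apply hne
        rw [dotProduct]
        refine Finset.sum_eq_zero fun j _ => ?_
        by_cases hj : p₂ j
        · rw [Pi.star_apply, hno j hj, star_zero, zero_mul]
        · rw [hAψ j hj, mul_zero]
      exact eigenvalue_ge_of_block hH p₂ hK₂ hgap₂ hev hvp
  have hΔγ : ∀ o, o ≠ none → γ ≤ Δ o := by
    intro o ho
    obtain ⟨i, rfl⟩ := Option.ne_none_iff_exists'.mp ho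
    rw [hΔ]
    simp only [Option.elim]
    split_ifs with hi
    · exact le_rfl
    · have := hgapmode i hi
      linarith
  have hab : a none = b none := by rw [ha, hb]; rfl
  have hKa : ∑ o, ‖a o‖ ≤ ‖A‖ * ‖B‖ := by
    rw [Fintype.sum_option]
    simp only [ha, Option.elim, norm_zero, zero_add, ha']
    exact sum_norm_weights_le hH A B hψ1
  have hKb : ∑ o, ‖b o‖ ≤ ‖A‖ * ‖B‖ := by
    rw [Fintype.sum_option]
    simp only [hb, Option.elim, norm_zero, zero_add, norm_neg, hb']
    rw [mul_comm]
    exact sum_norm_weights_le hH B A hψ1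
  have hh : ∀ t : ℝ, hfun t =
      ∑ o, (a o * cexp ((t * Δ o : ℝ) * I) - b o * cexp (-(t * Δ o : ℝ) * I)) := by
    intro t
    rw [hhfun, anticommutator_expect_eq_sum hH A B hψ t, Fintype.sum_option]
    simp only [ha, hb, Option.elim, zero_mul, sub_zero, zero_add]
    refine Finset.sum_congr rfl fun i _ => ?_
    rw [hΔ]
    simp only [Option.elim]
    by_cases hi : a' i = 0 ∧ b' i = 0
    · rw [← ha' i, ← hb' i, hi.1, hi.2]
      simp
    · rw [if_neg hi, ← ha' i, ← hb' i]
      ring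
  have hL1 : ∀ t : ℝ, 0 < t → ‖hfun t - hfun (-t)‖ ≤ 4 * ‖A‖ * (2 * ‖B‖ * (cY * N)) * t := by
    intro t ht
    rw [hhfun, hhfun]
    set X := heisenbergEvolution H t B - heisenbergEvolution H (-t) B with hX
    have hdiff : star ψ ⬝ᵥ ((A * heisenbergEvolution H t B + heisenbergEvolution H t B * A) *ᵥ ψ) -
        star ψ ⬝ᵥ ((A * heisenbergEvolution H (-t) B + heisenbergEvolution H (-t) B * A) *ᵥ ψ) =
        star ψ ⬝ᵥ ((A * X + X * A) *ᵥ ψ) := by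
      rw [← dotProduct_sub, ← sub_mulVec]
      congr 2
      rw [hX]
      noncomm_ring
    rw [hdiff]
    have hXn : ‖X‖ ≤ 2 * ‖B‖ * (cY * N) * (2 * t) := by
      rw [hX]
      refine (norm_heisenbergEvolution_sub_le hH B (-t) t).trans ?_
      rw [show t - -t = 2 * t by ring, abs_of_pos (by positivity)]
      exact mul_le_mul_of_nonneg_right hcomm (by positivity)
    calc ‖star ψ ⬝ᵥ ((A * X + X * A) *ᵥ ψ)‖ ≤ ‖A * X + X * A‖ := norm_vectorState_le hψ1 _
      _ ≤ ‖A * X‖ + ‖X * A‖ := norm_add_le _ _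
      _ ≤ ‖A‖ * ‖X‖ + ‖X‖ * ‖A‖ := add_le_add (l2_opNorm_mul _ _) (l2_opNorm_mul _ _)
      _ = 2 * ‖A‖ * ‖X‖ := by ring
      _ ≤ 2 * ‖A‖ * (2 * ‖B‖ * (cY * N) * (2 * t)) := by gcongr
      _ = 4 * ‖A‖ * (2 * ‖B‖ * (cY * N)) * t := by ring
  have hL2 : ∀ t : ℝ, ‖hfun t‖ ≤
      C * ‖B‖ * ‖A‖ * mXY * Real.exp (-μ * D) * Real.exp (μ * v * |t|) := by
    intro t
    rw [hhfun]
    calc ‖star ψ ⬝ᵥ ((A * heisenbergEvolution H t B + heisenbergEvolution H t B * A) *ᵥ ψ)‖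
        ≤ ‖A * heisenbergEvolution H t B + heisenbergEvolution H t B * A‖ := norm_vectorState_le hψ1 _
      _ = ‖heisenbergEvolution H t B * A + A * heisenbergEvolution H t B‖ := by rw [add_comm]
      _ ≤ C * ‖B‖ * ‖A‖ * mXY * Real.exp (-μ * (D - v * |t|)) := hLR t
      _ = _ := by
          rw [show -μ * (D - v * |t|) = -μ * D + μ * v * |t| by ring, Real.exp_add, ← mul_assoc]
  have hL3 : ∀ t : ℝ, ‖hfun t‖ ≤ 2 * ‖A‖ * ‖B‖ := by
    intro t
    rw [hhfun]
    calc ‖star ψ ⬝ᵥ ((A * heisenbergEvolution H t B + heisenbergEvolution H t B * A) *ᵥ ψ)‖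
        ≤ ‖A * heisenbergEvolution H t B + heisenbergEvolution H t B * A‖ := norm_vectorState_le hψ1 _
      _ ≤ ‖A * heisenbergEvolution H t B‖ + ‖heisenbergEvolution H t B * A‖ := norm_add_le _ _
      _ ≤ ‖A‖ * ‖heisenbergEvolution H t B‖ + ‖heisenbergEvolution H t B‖ * ‖A‖ :=
          add_le_add (l2_opNorm_mul _ _) (l2_opNorm_mul _ _)
      _ = 2 * ‖A‖ * ‖B‖ := by rw [norm_heisenbergEvolution_holds hH]; ring
  -- parameters
  have hα : 0 < γ * v / D := div_pos (mul_pos hγ hv) hD0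
  have ht₁ : 0 < Real.exp (-(μ * D / 4)) := Real.exp_pos _
  have hT : Real.exp (-(μ * D / 4)) ≤ D / (2 * v) := exp_le_div_of_le hμ hv hD0 hD2v
  have key := abstract_clustering_bound none Δ a b hfun hγ hα ht₁ hT (mul_pos hμ hv).le hΔ₀ hΔγ
    hab hKa hKb hh hL1 hL2 hL3
  -- `h(0) = 0` and the sum over `o ≠ none` is `⟨ψ, ABψ⟩`
  have h0 : hfun 0 = 0 := by
    rw [hhfun, heisenbergEvolution_zero, hAB, zero_mulVec, dotProduct_zero]
  have hsum : ∑ o ∈ univ.erase none, a o = opExpect (A * B) ψ := by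
    have h1 : ∑ o ∈ univ.erase (none : Option m), a o = ∑ i : m, a' i := by
      rw [← Finset.sum_erase_add _ _ (Finset.mem_univ none)] at *
      have := Fintype.sum_option a
      rw [ha none] at this
      simp only [Option.elim, zero_add] at this
      have h2 : ∑ o, a o = ∑ o ∈ univ.erase none, a o + a none := (Finset.sum_erase_add _ _ (Finset.mem_univ none)).symm
      rw [h2, ha none] at this
      simp only [Option.elim, add_zero] at this
      rw [this]
      refine Finset.sum_congr rfl fun i _ => ?_
      rw [ha]; rfl
    rw [h1]
    simp only [ha']
    rw [sum_dotProduct_mulVec_mul_dotProduct hH A ψ (B *ᵥ ψ), opExpect, ← mulVec_mulVec]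
  rw [hsum, h0, norm_zero] at key
  exact clustering_arith hC hμ hv hγ hN hD1 hD2v (norm_nonneg A) (norm_nonneg B) hcY hm0 hm key

end Literature.MathematicalPhysics.QuantumLattice
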